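import Summits.ResolutionOfSingularities.ResolutionOfSingularities.Theorems.LossEpisodePencil
import HarnessLib

/-!
# LossEntryW30 — decomp-res lens-3 g29 «LossEntryWalk», landing part 30 (slice 22): START — the in-wall slice of the
first wall state after a loss from a run state

Residual `stmt-ResolutionOfSingularities-27367`.  Tree-only imports (`LossEpisodePencil`); independent of parts 12–29.

After a LOSS move at a run state `t` (`IsRunState W s t i j l k m`: boundary `k·e_i + m·e_j`, `u_j^m`-layer
`c·u_i^k u_j^m u_l^s·V`, `c·V(0) ≠ 0`; tail hypotheses), the next state is a one-wall state on `u_{j_t}`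
(`LossEpisode.runState_next`), and its IN-WALL SLICE (`m' (j_t) = 0`, `|m'| = s`) is read off the residual form of the
move by `ConeCut.restriction_of_plateau`; the three gen-28 residual-form laws give it in closed form:

* `wall_slice_after_loss_b` (chart `j`, `LossExitCone.exit_resForm`): `U·c·V(0) · coeff_{m'} (u_l^s)` — root `0` in the
  frame `(j; i, l)`;
* `wall_slice_after_loss_c` (chart `l`, `LossExitCone.switch_law`): `U·c·V(0)/(−b_t(j))^s · coeff_{m'} (u_j^s)` — root
  `0` in the frame `(l; i, j)`;
* `wall_slice_after_loss_a` (chart `i`, `b_t(j) ≠ 0`, `LossPencil.lossA_law`):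
  `U·c·V(0) · coeff_{m'} ((u_l − (b_t(l)/b_t(j))·u_j)^s)` — root `b_t(l)/b_t(j)` in the frame `(i; j, l)`.

(`U = ConeCut.bUnit W t ≠ 0`.)  These are the START data of the forward purity propagation (parts 25–29) along the
loss chain of `LossEpisode.lawLossEntryAt_of_wallSteps'` (part 12).  Complete proofs, standard axioms.

(Sources: Hauser2010 §F; HauserPerlega2019 §2; CossartJannsenSaito2020 Ch. 8; Moh1987; Perlega2022.)
-/

open MvPolynomial Finset
open Literature.AlgebraicGeometry.Resolution
open Literature.AlgebraicGeometry.Resolution.Hauser2010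
open Literature.AlgebraicGeometry.Resolution.PointBlowup
open Summit.ResolutionOfSingularities.ResolutionOfSingularities.Theorems.TightDefectClasses
open Summit.ResolutionOfSingularities.ResolutionOfSingularities.Theorems.TightDefectStrongWalks
open Summit.ResolutionOfSingularities.ResolutionOfSingularities.Theorems.ItineraryCutClasses
open Summit.ResolutionOfSingularities.ResolutionOfSingularities.Theorems.BoundaryLedger
open Summit.ResolutionOfSingularities.ResolutionOfSingularities.Theorems.ProximityCut
open Summit.ResolutionOfSingularities.ResolutionOfSingularities.Theorems.ConeCut
open Summit.ResolutionOfSingularities.ResolutionOfSingularities.Theorems.LossExitCone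
open Summit.ResolutionOfSingularities.ResolutionOfSingularities.Theorems.LossPencil

namespace Summit.ResolutionOfSingularities.ResolutionOfSingularities.Theorems.LossEpisode

section StartSlices

variable {K : Type} [Field K] [DecidableEq K] {q : ℕ} {s₀ : State (Fin 3) K} {W : ForcedWalk q s₀} {N s : ℕ}

/-- **START, (b) presentation (PROVED):** after a move in the chart of the LOSS WALL `j` at a run state, the in-wall
slice of the next state (wall `u_j`) is `U·c·V(0)·u_l^s`. [new] [folklore] -/
theorem wall_slice_after_loss_b (hroot : IsRoot q s₀) (hT : TailHyp W N s) {t : ℕ} (hNt : N ≤ t) {i j l : Fin 3}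
    {k m : ℕ} (hS : IsRunState W s t i j l k m) (hjt : W.j t = j) :
    ∃ φ : K, φ ≠ 0 ∧ ∀ m' : Fin 3 →₀ ℕ, m' j = 0 → m'.degree = s →
      coeff ((W.st (t + 1)).r + m') (W.st (t + 1)).F = φ * coeff m' (X l ^ s) := by
  classical
  have hled := runState_ledger hroot hT hNt hS
  obtain ⟨hij, hli, hlj, h1k, h1m, hr, c, V, hc, hV, hlayer⟩ := hS
  have hsh : (W.st t).shade = (s : ℕ∞) := hT.shade t hNt
  have hplat : (W.st (t + 1)).shade = (W.st t).shade := hled.2.2.2.2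
  have hq : q < s + k + m := hled.2.1
  subst hjt
  obtain ⟨ho, hres⟩ := exit_resForm hroot W t hij hlj hr hsh hplat hq hlayer
  refine ⟨bUnit W t * (c * coeff 0 V), mul_ne_zero (bUnit_ne_zero W t) (mul_ne_zero hc (by rwa [← constantCoeff_eq])),
    fun m' hm'j hm' => ?_⟩
  rw [restriction_of_plateau hroot W t ho hq hplat hsh m' hm'j hm', hres, coeff_C_mul]
  ring

/-- **START, (c) presentation (PROVED):** after a move in the chart of the FREE LETTER `l` at a run state, the
in-wall slice of the next state (wall `u_l`) is `U·c·V(0)/(−b_t(j))^s·u_j^s` (and `b_t(j) ≠ 0`). [new] [folklore] -/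
theorem wall_slice_after_loss_c (hroot : IsRoot q s₀) (hT : TailHyp W N s) {t : ℕ} (hNt : N ≤ t) {i j l : Fin 3}
    {k m : ℕ} (hS : IsRunState W s t i j l k m) (hlt : W.j t = l) :
    W.b t j ≠ 0 ∧ ∃ φ : K, φ ≠ 0 ∧ ∀ m' : Fin 3 →₀ ℕ, m' l = 0 → m'.degree = s →
      coeff ((W.st (t + 1)).r + m') (W.st (t + 1)).F = φ * coeff m' (X j ^ s) := by
  classical
  have hled := runState_ledger hroot hT hNt hS
  obtain ⟨hij, hli, hlj, h1k, h1m, hr, c, V, hc, hV, hlayer⟩ := hS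
  have hsh : (W.st t).shade = (s : ℕ∞) := hT.shade t hNt
  have hplat : (W.st (t + 1)).shade = (W.st t).shade := hled.2.2.2.2
  have hq : q < s + k + m := hled.2.1
  have ha : c * coeff 0 V ≠ 0 := mul_ne_zero hc (by rwa [← constantCoeff_eq])
  subst hlt
  obtain ⟨ho, hbj, hres⟩ := switch_law hroot W t (Ne.symm hli) (Ne.symm hlj) hij hr hsh hplat hq hT.one_le ha hlayer
  refine ⟨hbj, bUnit W t * ((c * coeff 0 V) / (-W.b t j) ^ s),
    mul_ne_zero (bUnit_ne_zero W t) (div_ne_zero ha (pow_ne_zero _ (neg_ne_zero.mpr hbj))), fun m' hm'l hm' => ?_⟩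
  rw [restriction_of_plateau hroot W t ho hq hplat hsh m' hm'l hm', hres, coeff_C_mul]
  ring

/-- **START, (a) presentation (PROVED):** after a move in the chart of the RUN WALL `i` translated off the loss wall
(`b_t(j) ≠ 0`) at a run state, the in-wall slice of the next state (wall `u_i`) is
`U·c·V(0)·(u_l − (b_t(l)/b_t(j))·u_j)^s`. [new] [folklore] -/
theorem wall_slice_after_loss_a (hroot : IsRoot q s₀) (hT : TailHyp W N s) {t : ℕ} (hNt : N ≤ t) {i j l : Fin 3}
    {k m : ℕ} (hS : IsRunState W s t i j l k m) (hit : W.j t = i) (hbj : W.b t j ≠ 0) :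
    ∃ φ : K, φ ≠ 0 ∧ ∀ m' : Fin 3 →₀ ℕ, m' i = 0 → m'.degree = s →
      coeff ((W.st (t + 1)).r + m') (W.st (t + 1)).F =
        φ * coeff m' ((X l - C (W.b t l / W.b t j) * X j) ^ s) := by
  classical
  have hled := runState_ledger hroot hT hNt hS
  obtain ⟨hij, hli, hlj, h1k, h1m, hr, c, V, hc, hV, hlayer⟩ := hS
  have hsh : (W.st t).shade = (s : ℕ∞) := hT.shade t hNt
  have hplat : (W.st (t + 1)).shade = (W.st t).shade := hled.2.2.2.2
  have hq : q < s + k + m := hled.2.1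
  subst hit
  obtain ⟨ho, hres⟩ := lossA_law hroot W t (Ne.symm hij) hli hlj hr hsh hplat hq hlayer hbj
  refine ⟨bUnit W t * (c * coeff 0 V), mul_ne_zero (bUnit_ne_zero W t) (mul_ne_zero hc (by rwa [← constantCoeff_eq])),
    fun m' hm'i hm' => ?_⟩
  rw [restriction_of_plateau hroot W t ho hq hplat hsh m' hm'i hm', hres, coeff_C_mul]
  ring

end StartSlices

end Summit.ResolutionOfSingularities.ResolutionOfSingularities.Theorems.LossEpisode
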